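import Summits.RiemannHypothesis.RiemannHypothesis.Theorems.ThetaTier2RowSound
import HarnessLib

/-!
# THETA tier-2 kernel rows — twin primes `6779 ≤ q ≤ 7589` (module 10 of 13; cc-s2-1, WEIL typing lane; RH-FREE bookkeeping)

Data module of the tier-2 theta certificate (THETA-CERT-cc6 §E; HOME/cc-s2-1/gen22/TIER2-KERNEL-SPEC.md; soundness chain
`ThetaTier2Check … ThetaTier2RowSound`): the rows `(q, q⁺, m, δ·10¹², menu, k)` — `m = 5`, `δ = ⌊0.98·δ_q·10¹²⌋/10¹²` with
`δ_q = ½ log(q⁺/q)`, menu `0` = thin seed `(1/20, 19/20, 1)`, `η′ = 1/100` (menu `1` = `(1/4, 3/5, 1)`, `η′ = 1/20` for `q = 179, 191`),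
`t₀ = 2⁻¹⁵`; `K = 6`, `τ = 1/100`, `D = 3`, `W_l = 4`, `J = 64` — for the twin primes `6779 ≤ q ≤ 7589` in the range of the route item
`stmt-RiemannHypothesis-19172` (`WallsTenKTwin`, `route-RiemannHypothesis-WeilSemilocal`), checked in the kernel by `Row2.check`
(`decide +kernel`, ≈ 14 s per row), and the resulting REAL statements `T2Valid r.inp r.real ∧ r.RowFacts` (`Row2.check_sound`) that the
E-side assembly turns into `UC(q)`.  Nothing here bears on the truth of RH.
-/

set_option linter.dupNamespace false  -- the mandated namespace repeats `RiemannHypothesis`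

namespace Summit.RiemannHypothesis.RiemannHypothesis.Theorems.ThetaTier2

/-- Twin rows `6779 ≤ q ≤ 7211` (8 rows). [this cell, TIER2-KERNEL-SPEC §4] -/
def twinRows10_1 : List Row2 := [
  ⟨6779, 6781, 5, 144542773, 0, 15⟩, ⟨6791, 6793, 5, 144287397, 0, 15⟩, ⟨6827, 6829, 5, 143526655, 0, 15⟩, ⟨6869, 6871, 5, 142649200, 0, 15⟩,
  ⟨6947, 6949, 5, 141047784, 0, 15⟩, ⟨6959, 6961, 5, 140804598, 0, 15⟩, ⟨7127, 7129, 5, 137485971, 0, 15⟩, ⟨7211, 7213, 5, 135884637, 0, 15⟩ ]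

/-- The kernel verdict for `twinRows10_1`. [this cell, THETA-CERT-cc6 §E6] -/
theorem twinRows10_1_check : twinRows10_1.all Row2.check = true := by
  decide +kernel

/-- (K1)–(K7) and the row facts at every row of `twinRows10_1`. [this cell, THETA-CERT-cc6 §E6] -/
theorem twinRows10_1_valid : ∀ r ∈ twinRows10_1, T2Valid r.inp r.real ∧ r.RowFacts :=
  fun r hr => r.check_sound (List.all_eq_true.1 twinRows10_1_check r hr)

/-- Twin rows `7307 ≤ q ≤ 7589` (8 rows). [this cell, TIER2-KERNEL-SPEC §4] -/
def twinRows10_2 : List Row2 := [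
  ⟨7307, 7309, 5, 134099617, 0, 15⟩, ⟨7331, 7333, 5, 133660666, 0, 15⟩, ⟨7349, 7351, 5, 133333334, 0, 15⟩, ⟨7457, 7459, 5, 131402521, 0, 15⟩,
  ⟨7487, 7489, 5, 130876069, 0, 15⟩, ⟨7547, 7549, 5, 129835718, 0, 15⟩, ⟨7559, 7561, 5, 129629630, 0, 15⟩, ⟨7589, 7591, 5, 129117260, 0, 15⟩ ]

/-- The kernel verdict for `twinRows10_2`. [this cell, THETA-CERT-cc6 §E6] -/
theorem twinRows10_2_check : twinRows10_2.all Row2.check = true := by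
  decide +kernel

/-- (K1)–(K7) and the row facts at every row of `twinRows10_2`. [this cell, THETA-CERT-cc6 §E6] -/
theorem twinRows10_2_valid : ∀ r ∈ twinRows10_2, T2Valid r.inp r.real ∧ r.RowFacts :=
  fun r hr => r.check_sound (List.all_eq_true.1 twinRows10_2_check r hr)

end Summit.RiemannHypothesis.RiemannHypothesis.Theorems.ThetaTier2
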